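import Summits.CriticalPhenomena.PercolationContinuityZ3.Theorems.PercNearOneGluingNoHeavyLowerTailSahiE3BlocksOver
import Summits.CriticalPhenomena.PercolationContinuityZ3.Theorems.PercNearOneGluingNoHeavyLowerTailSahiE3DnfWidthTwoKahn
import Mathlib.Tactic.FinCases
import Mathlib.Tactic.Linarith
import Mathlib.Tactic.Ring
import Mathlib.Tactic.Positivity
import HarnessLib
import HarnessLib.Audit

/-!
# `NoHeavyLowerTail` (crux stmt-CriticalPhenomena-4575), Sahi programme P4: SAHI'S `C₃` / KAHN'S CONJECTURE 5 FOR EVERY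
# READ-ONCE DNF `⋁ᵢ ⋀_{x ∈ Cᵢ} x` — any number of clauses, ANY WIDTHS, every product weight

Support file (cell `prim-l12`, seat P4, generation 15; `--supports stmt-CriticalPhenomena-4575`).  No named facts, no sorries;
standard axioms; def-free.

A read-once DNF on a finite set of variables `σ` is given by a clause map `c : σ → Fin m` (variable `x` belongs to clause `c x`);
its slot is `U = {t : σ → Bool | ∃ i, ∀ x, c x = i → t x}`.
* `harris_boolCube`, `harris_boolPow`: Harris' inequality for product weights on `Fin k → Bool` / `ι → Bool`.
* `cert_dnf_cube`: the flow certificate of `U` for every product weight `C · ∏_x w_x(t_x)` (`w, C ≥ 0`) — `…SahiE3BlocksOver.cert_blocks_over`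
  with the blocks `Bᵢ = ({x // c x = i} → Bool)` (tops = all-true, Harris by `harris_boolPow`) over the trivial base, transported
  along `(Π i, Bᵢ) × Unit ≃o (σ → Bool)`.
* `latticeE3_nonneg_of_dnf`: by the kernel theorem `…SahiE3PatternCertificate.latticeE3_nonneg_of_patternCertificate`,
  `0 ≤ latticeE3 μ U A B` on every finite distributive lattice (`μ ≥ 0` log-supermodular, join-primes `j : σ → L`, up-sets `A, B`,
  slot `{y | ∃ i, ∀ x, c x = i → j x ≤ y}`) whenever the pattern marginal is a product weight.
* `latticeE3_nonneg_dnf_prod`: the Boolean form, `μ(ω) = ∏_{u ∈ ω} θ_u` on `2^κ`, distinct generators `v : σ → κ`, first slot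
  `{ω | ∃ i, ∀ x, c x = i → v x ∈ ω}`, arbitrary up-sets `A, B`.
* `kahn_of_dnf` (namespace `…SahiE3DnfKahn`): the `prodBernoulli` form — for every finite `ι`, `p : ι → [0,1]`, injective `v : σ → ι`,
  clause map `c`, and ALL increasing `A, B ⊆ Set ι`: `0 ≤ sahiE3 (prodBernoulli p) {ω | ∃ i, ∀ x, c x = i → v x ∈ ω} A B` — Kahn's
  Conjecture 5 [Kahn, arXiv:2210.08653, Conj. 5] whenever the first event is a read-once DNF (bridge `Literature…sahiE_three_ind`, as in
  `…SahiE3DnfWidthTwoKahn`).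
This supersedes `…SahiE3DnfWidthTwo` (all clauses of width two) and the hitting-set slot theorems (all of width one).
HOME prim-l12-p4/FROM-prim-l12-p4-gen15-BLOCK-OR-STEP.md.
-/

namespace Summit.CriticalPhenomena.PercolationContinuityZ3.Theorems.SahiE3Dnf

open Finset SahiE3BlocksOver SahiE3LroTransport SahiE3LroLayers SahiE3LroAndStep SahiE3DimerOver
open scoped BigOperators

/-! ### Harris' inequality for product weights on Boolean cubes -/

/-- Harris' inequality for a product weight on `Fin k → Bool`. [folklore] -/
theorem harris_boolCube : ∀ (k : ℕ) (w : Fin k → Bool → ℝ) (_hw : ∀ i b, 0 ≤ w i b) (ν : (Fin k → Bool) → ℝ)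
    (_hν : ∀ t, ν t = ∏ i, w i (t i)) (S S' : Finset (Fin k → Bool)), IsUpperSet (S : Set (Fin k → Bool)) →
    IsUpperSet (S' : Set (Fin k → Bool)) → (∑ t ∈ S, ν t) * (∑ t ∈ S', ν t) ≤ (∑ t, ν t) * ∑ t ∈ S ∩ S', ν t := by
  intro k
  induction k with
  | zero =>
    intro w _ ν _ S S' _ _
    exact harris_subsingleton ν S S'
  | succ n ih =>
    intro w hw ν hν S S' hS hS'
    obtain ⟨ν', hν'⟩ : ∃ f : (Fin n → Bool) → ℝ, ∀ t, f t = ∏ i, w i.succ (t i) := ⟨_, fun _ => rfl⟩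
    have hν'0 : ∀ t, 0 ≤ ν' t := fun t => by rw [hν']; exact Finset.prod_nonneg fun i _ => hw _ _
    have hH' := ih (fun i => w i.succ) (fun i b => hw _ _) ν' hν'
    obtain ⟨ν₂, hν₂⟩ : ∃ f : Bool × (Fin n → Bool) → ℝ, ∀ y,
        f y = (if y.1 = true then w 0 true else w 0 false) * ν' y.2 := ⟨_, fun _ => rfl⟩
    have hH₂ := harris_layers hν'0 hH' (hw 0 true) (hw 0 false) ν₂ (fun t => by rw [hν₂]; simp)
      (fun t => by rw [hν₂]; simp)
    let e := Fin.consOrderIso (fun _ : Fin (n + 1) => Bool)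
    have hes : ∀ y : Fin (n + 1) → Bool, e.symm y = (y 0, Fin.tail y) := fun y => rfl
    have hνe : ∀ y : Fin (n + 1) → Bool, ν y = ν₂ (e.symm y) := fun y => by
      rw [hes, hν₂, hν, Fin.prod_univ_succ, hν']
      cases y 0 <;> simp [Fin.tail]
    exact harris_transport e _ hνe hH₂ S S' hS hS'

/-- Harris' inequality for a product weight on `ι → Bool`, `ι` any finite index type. [folklore] -/
theorem harris_boolPow {ι : Type*} [Fintype ι] [DecidableEq ι] (w : ι → Bool → ℝ) (hw : ∀ i b, 0 ≤ w i b) (ν : (ι → Bool) → ℝ)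
    (hν : ∀ t, ν t = ∏ i, w i (t i)) (S S' : Finset (ι → Bool)) (hS : IsUpperSet (S : Set (ι → Bool)))
    (hS' : IsUpperSet (S' : Set (ι → Bool))) : (∑ t ∈ S, ν t) * (∑ t ∈ S', ν t) ≤ (∑ t, ν t) * ∑ t ∈ S ∩ S', ν t := by
  set q := Fintype.equivFin ι with hq
  let e : (Fin (Fintype.card ι) → Bool) ≃o (ι → Bool) :=
    { toFun := fun f x => f (q x)
      invFun := fun g i => g (q.symm i)
      left_inv := fun f => by funext i; simp
      right_inv := fun g => by funext x; simp
      map_rel_iff' := by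
        intro f g
        constructor
        · intro h i; simpa using h (q.symm i)
        · intro h x; exact h (q x) }
  have hνe : ∀ g : ι → Bool, ν g = (fun f : Fin (Fintype.card ι) → Bool => ∏ i, w (q.symm i) (f i)) (e.symm g) := by
    intro g
    rw [hν]
    show ∏ i, w i (g i) = ∏ i, w (q.symm i) (g (q.symm i))
    exact (Fintype.prod_equiv q.symm (fun i => w (q.symm i) (g (q.symm i))) (fun i => w i (g i)) fun i => rfl).symm
  exact harris_transport e ν hνe (harris_boolCube _ (fun i => w (q.symm i)) (fun i b => hw _ _) _ (fun _ => rfl)) S S' hS hS'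

/-! ### The certificate of a read-once DNF -/

/-- **The certificate of `⋁ᵢ ⋀_{c x = i} x` on the pattern cube** `σ → Bool` with the product weight `ν(t) = C · ∏_x w_x(t_x)`
(`w, C ≥ 0`), clauses given by `c : σ → Fin m`: the slot `U = {t | ∃ i, ∀ x, c x = i → t x}` is an up-set and carries a flow certificate
with exact deliveries. [this work] -/
theorem cert_dnf_cube {σ : Type*} [Fintype σ] [DecidableEq σ] (m : ℕ) (c : σ → Fin m) (w : σ → Bool → ℝ) (hw : ∀ x b, 0 ≤ w x b)
    {C : ℝ} (hC : 0 ≤ C) (ν : (σ → Bool) → ℝ) (hν : ∀ t, ν t = C * ∏ x, w x (t x))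
    (U : Finset (σ → Bool)) (hU : ∀ t, t ∈ U ↔ ∃ i, ∀ x, c x = i → t x = true) :
    IsUpperSet (U : Set (σ → Bool)) ∧
    ∃ (R : (σ → Bool) → ℝ) (Fl : (σ → Bool) → (σ → Bool) → ℝ),
      (∀ t ∈ U, 0 ≤ R t) ∧ (∀ t s, 0 ≤ Fl t s) ∧ (∀ t s, Fl t s ≠ 0 → s ≤ t) ∧
      (∀ t ∈ U, R t + ∑ s ∈ Uᶜ, Fl t s ≤ (∑ r, ν r) * ((∑ r, ν r) + ∑ r ∈ Uᶜ, ν r) * ν t) ∧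
      (∀ s ∈ Uᶜ, ∑ t ∈ U, Fl t s = (∑ r, ν r) * (∑ r ∈ U, ν r) * ν s) ∧
      (∀ S S' : Finset (σ → Bool), IsUpperSet (S : Set (σ → Bool)) →
        IsUpperSet (S' : Set (σ → Bool)) →
        (∑ r, ν r) * ((∑ t ∈ S, ν t) * (∑ t ∈ S' ∩ U, ν t) + (∑ t ∈ S', ν t) * (∑ t ∈ S ∩ U, ν t))
            - (∑ r ∈ U, ν r) * (∑ t ∈ S, ν t) * (∑ t ∈ S', ν t) ≤ ∑ t ∈ (S ∩ S') ∩ U, R t) := by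
  -- the trivial base
  have hHQ : ∀ S S' : Finset Unit, IsUpperSet (S : Set Unit) → IsUpperSet (S' : Set Unit) →
      (∑ t ∈ S, (fun _ : Unit => C) t) * (∑ t ∈ S', (fun _ : Unit => C) t)
        ≤ (∑ t, (fun _ : Unit => C) t) * ∑ t ∈ S ∩ S', (fun _ : Unit => C) t :=
    fun S S' _ _ => harris_subsingleton _ S S'
  have hG : IsUpperSet (((∅ : Finset Unit) : Finset Unit) : Set Unit) := by simp [isUpperSet_empty]
  -- the blocks `{x // c x = i} → Bool`
  obtain ⟨hUp, -, R, Fl, c1, c2, c3, c4, c5, c6⟩ := cert_blocks_over (Q := Unit) (νQ := fun _ => C) (fun _ => hC) hHQ ∅ hG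
    (fun _ => 0) (fun _ _ => 0) (fun t ht => absurd ht (Finset.notMem_empty t)) (fun _ _ => le_rfl)
    (fun _ _ h => absurd rfl h) (fun t ht => absurd ht (Finset.notMem_empty t)) (fun s _ => by simp) (fun S S' _ _ => by simp)
    m (fun i => {x : σ // c x = i} → Bool) (fun i => fun _ => true) (fun i b xs => Bool.le_true _)
    (fun i f => ∏ xs : {x : σ // c x = i}, w xs.1 (f xs))
    (fun i f => Finset.prod_nonneg fun xs _ => hw _ _)
    (fun i => harris_boolPow (fun xs : {x : σ // c x = i} => w xs.1) (fun xs b => hw _ _) _ (fun _ => rfl))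
    (fun y => (∏ i, ∏ xs : {x : σ // c x = i}, w xs.1 (y.1 i xs)) * C) (fun _ => rfl)
    (univ.filter fun y : (∀ i : Fin m, {x : σ // c x = i} → Bool) × Unit =>
      (∃ i, y.1 i = fun _ => true) ∨ y.2 ∈ (∅ : Finset Unit)) (fun y => by simp)
  -- transport to the cube `σ → Bool`
  let e : ((∀ i : Fin m, {x : σ // c x = i} → Bool) × Unit) ≃o (σ → Bool) :=
    { toFun := fun y x => y.1 (c x) ⟨x, rfl⟩
      invFun := fun t => (fun i xs => t xs.1, ())
      left_inv := fun y => by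
        rcases y with ⟨f, u⟩
        simp only [Prod.mk.injEq]
        refine ⟨?_, trivial⟩
        funext i xs
        obtain ⟨x, rfl⟩ := xs
        rfl
      right_inv := fun t => by funext x; rfl
      map_rel_iff' := by
        rintro ⟨f, u⟩ ⟨g, u'⟩
        simp only [Equiv.coe_fn_mk, Prod.mk_le_mk, Pi.le_def]
        constructor
        · intro h
          refine ⟨fun i xs => ?_, le_of_eq (Subsingleton.elim _ _)⟩
          obtain ⟨x, rfl⟩ := xs
          exact h x
        · rintro ⟨h, -⟩ x
          exact h (c x) ⟨x, rfl⟩ }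
  have hes : ∀ t : σ → Bool, e.symm t = (fun i xs => t xs.1, ()) := fun t => rfl
  have hνe : ∀ t, ν t = (fun y : (∀ i : Fin m, {x : σ // c x = i} → Bool) × Unit =>
      (∏ i, ∏ xs : {x : σ // c x = i}, w xs.1 (y.1 i xs)) * C) (e.symm t) := by
    intro t
    rw [hes, hν, mul_comm]
    congr 1
    rw [← Fintype.prod_sigma (fun p : Σ i : Fin m, {x : σ // c x = i} => w p.2.1 (t p.2.1))]
    exact (Fintype.prod_equiv (Equiv.sigmaFiberEquiv c) _ _ fun p => rfl).symm
  have hUe : ∀ t, t ∈ U ↔ e.symm t ∈ (univ.filter fun y : (∀ i : Fin m, {x : σ // c x = i} → Bool) × Unit =>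
      (∃ i, y.1 i = fun _ => true) ∨ y.2 ∈ (∅ : Finset Unit)) := by
    intro t
    rw [hes, hU, Finset.mem_filter]
    simp only [Finset.mem_univ, true_and, Finset.notMem_empty, or_false]
    refine exists_congr fun i => ?_
    constructor
    · intro h; funext xs; exact h xs.1 xs.2
    · intro h x hx; exact congrFun h ⟨x, hx⟩
  obtain ⟨R', Fl', d1, d2, d3, d4, d5, d6⟩ := cert_transport e c1 c2 c3 c4 c5 c6 ν hνe U hUe
  refine ⟨?_, R', Fl', d1, d2, d3, d4, d5, d6⟩
  intro x y hxy hx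
  simp only [Finset.mem_coe] at hx ⊢
  rw [hUe] at hx ⊢
  exact hUp (e.symm.monotone hxy) hx

/-! ### The lattice theorem and the Boolean form -/

section Lattice

open Literature.Probability.LatticeModels

variable {α : Type*} [DistribLattice α] [Fintype α] [DecidableEq α] [DecidableLE α]

open scoped Classical in
/-- **Sahi's `C₃` / Kahn's Conjecture 5 for read-once DNFs over join-primes.**  `L` finite distributive, `μ ≥ 0` log-supermodular,
`j : σ → L` join-primes, clauses `c : σ → Fin m`, `A, B` up-sets, slot `U = {y | ∃ i, ∀ x, c x = i → j x ≤ y}`.  If the pattern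
marginal `t ↦ m{y | (j x ≤ y)_x = t}` is a product weight `C · ∏_x w_x(t_x)` (`w, C ≥ 0`), then `0 ≤ latticeE3 μ U A B`. [this work] -/
theorem latticeE3_nonneg_of_dnf {μ : α → ℝ} (hμ₀ : 0 ≤ μ)
    (hμ : ∀ x y, μ x * μ y ≤ μ (x ⊓ y) * μ (x ⊔ y)) {σ : Type*} [Fintype σ] [DecidableEq σ] (m : ℕ) (c : σ → Fin m)
    {j : σ → α} (hj : ∀ x, SupPrime (j x)) {F : (σ → Bool) → Finset α}
    (hF : ∀ (t : σ → Bool) (y : α), y ∈ F t ↔ ∀ x, (j x ≤ y ↔ t x = true))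
    {A B : Finset α} (hA : IsUpperSet (A : Set α)) (hB : IsUpperSet (B : Set α))
    (w : σ → Bool → ℝ) (hw : ∀ x b, 0 ≤ w x b) {C : ℝ} (hC : 0 ≤ C)
    (hν : ∀ t, mass μ (F t) = C * ∏ x, w x (t x))
    (U' : Finset (σ → Bool)) (hU' : ∀ t, t ∈ U' ↔ ∃ i, ∀ x, c x = i → t x = true) :
    0 ≤ latticeE3 μ (univ.filter fun y => (fun x => decide (j x ≤ y)) ∈ U') A B := by
  obtain ⟨-, R, Fl, h1, h2, h3, h4, h5, h6⟩ :=
    cert_dnf_cube m c w hw hC (fun t => C * ∏ x, w x (t x)) (fun _ => rfl) U' hU'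
  refine SahiE3PatternCertificate.latticeE3_nonneg_of_patternCertificate hμ₀ hμ hj hF hA hB U'
    (fun t => C * ∏ x, w x (t x)) (fun t => (hν t).symm) R Fl h1 h2 h3 h4 (fun s hs => (h5 s hs).ge) ?_
  intro S S' hS hS'
  have hz : ∑ s ∈ (S ∩ S') ∩ U'ᶜ, (∑ t ∈ U', Fl t s - (∑ r : σ → Bool, C * ∏ x, w x (r x)) *
      (∑ r ∈ U', C * ∏ x, w x (r x)) * (C * ∏ x, w x (s x))) = 0 :=
    Finset.sum_eq_zero fun s hs => by rw [h5 s (Finset.mem_inter.1 hs).2, sub_self]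
  rw [hz, add_zero]
  exact h6 S S' hS hS'

end Lattice

section Cube

open Literature.Probability.LatticeModels

variable {κ : Type*} [Fintype κ] [DecidableEq κ]

/-- **Kahn's Conjecture 5 for every read-once DNF first slot, product weights on `2^κ`.**  `μ(ω) = ∏_{u∈ω} θ_u` with `θ ≥ 0`,
distinct generators `v : σ → κ`, clauses `c : σ → Fin m`, `A, B` arbitrary up-sets:
`0 ≤ latticeE3 μ {ω | ∃ i, ∀ x, c x = i → v x ∈ ω} A B`. [this work] -/
theorem latticeE3_nonneg_dnf_prod {θ : κ → ℝ} (hθ : ∀ u, 0 ≤ θ u) {σ : Type*} [Fintype σ] [DecidableEq σ] (m : ℕ)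
    (c : σ → Fin m) {v : σ → κ} (hv : Function.Injective v) {A B : Finset (Finset κ)}
    (hA : IsUpperSet (A : Set (Finset κ))) (hB : IsUpperSet (B : Set (Finset κ))) :
    0 ≤ latticeE3 (fun ω : Finset κ => ∏ u ∈ ω, θ u)
      (univ.filter fun ω : Finset κ => ∃ i, ∀ x, c x = i → v x ∈ ω) A B := by
  classical
  set F : (σ → Bool) → Finset (Finset κ) :=
    fun t => univ.filter fun ω : Finset κ => ∀ l, (v l ∈ ω ↔ t l = true) with hFdef
  have hF : ∀ (t : σ → Bool) (ω : Finset κ), ω ∈ F t ↔ ∀ l, (v l ∈ ω ↔ t l = true) := by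
    intro t ω; simp [hFdef]
  have hF' : ∀ (t : σ → Bool) (ω : Finset κ), ω ∈ F t ↔ ∀ l, (({v l} : Finset κ) ≤ ω ↔ t l = true) := by
    intro t ω; rw [hF]; simp
  set C : ℝ := ∑ ω ∈ ((univ : Finset σ).image v)ᶜ.powerset, ∏ u ∈ ω, θ u with hC
  have hC0 : 0 ≤ C := Finset.sum_nonneg fun ω _ => Finset.prod_nonneg fun u _ => hθ u
  set w : σ → Bool → ℝ := fun p b => if b = true then θ (v p) else 1 with hw
  have hw0 : ∀ p b, 0 ≤ w p b := by
    intro p b; simp only [hw]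
    split_ifs
    · exact hθ _
    · exact zero_le_one
  have hν : ∀ t, mass (fun ω : Finset κ => ∏ u ∈ ω, θ u) (F t) = C * ∏ p, w p (t p) := by
    intro t
    rw [SahiE3LroCube.mass_fib_prod θ hv hF t, ← hC, hw, mul_comm]
  obtain ⟨U', hU'⟩ : ∃ V : Finset (σ → Bool), ∀ t, t ∈ V ↔ ∃ i, ∀ x, c x = i → t x = true :=
    ⟨univ.filter fun t => ∃ i, ∀ x, c x = i → t x = true, fun t => by simp⟩
  have key := latticeE3_nonneg_of_dnf (SahiE3HitSlotProduct.prod_nonneg' hθ) (SahiE3HitSlotProduct.prod_lsm θ) m c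
    (fun x => SahiE3CovHit.supPrime_singleton' (v x)) hF' hA hB w hw0 hC0 hν U' hU'
  have hslot : (univ.filter fun ω : Finset κ => (fun x => decide (({v x} : Finset κ) ≤ ω)) ∈ U') =
      univ.filter fun ω : Finset κ => ∃ i, ∀ x, c x = i → v x ∈ ω := by
    congr 1; ext ω; simp [hU']
  rw [hslot] at key
  exact key

end Cube

end Summit.CriticalPhenomena.PercolationContinuityZ3.Theorems.SahiE3Dnf

namespace Summit.CriticalPhenomena.PercolationContinuityZ3.Theorems.SahiE3DnfKahn

open Finset MeasureTheory Literature.Combinatorics.Sahi2008 Literature.Probability.Percolation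
open Literature.Probability.LatticeModels (prodBernoulli sahiE3 mass latticeE3)

variable {ι : Type*} [Fintype ι]

open scoped Classical in
/-- **Kahn's Conjecture 5 for every read-once DNF first slot.**  `ι` finite, `p : ι → [0,1]`, `v : σ → ι` injective, `c : σ → Fin m`;
then for ALL increasing `A, B ⊆ Set ι`: `0 ≤ sahiE3 (prodBernoulli p) {ω | ∃ i, ∀ x, c x = i → v x ∈ ω} A B`. [this work] -/
theorem kahn_of_dnf (p : ι → unitInterval) {σ : Type*} [Fintype σ] [DecidableEq σ] (m : ℕ) (c : σ → Fin m) {v : σ → ι}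
    (hv : Function.Injective v) {A B : Set (Set ι)} (hA : IsUpperSet A) (hB : IsUpperSet B) :
    0 ≤ sahiE3 (prodBernoulli p) {ω : Set ι | ∃ i, ∀ x, c x = i → v x ∈ ω} A B := by
  rw [← sahiE_three_ind]
  have hμ := isFKGMeasure_bernoulliWeight p
  have hA' : IsUpperSet ((A.toFinset : Finset (Set ι)) : Set (Set ι)) := by simpa using hA
  have hB' : IsUpperSet ((B.toFinset : Finset (Set ι)) : Set (Set ι)) := by simpa using hB
  have hF : ∀ (t : σ → Bool) (x : Set ι),
      x ∈ (univ.filter fun x : Set ι => ∀ i, (({v i} : Set ι) ≤ x ↔ t i = true)) ↔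
        ∀ i, (({v i} : Set ι) ≤ x ↔ t i = true) := fun t x => by simp
  have hw : ∀ (i : σ) (b : Bool), 0 ≤ (if b = true then (p (v i) : ℝ) else 1 - (p (v i) : ℝ)) := by
    intro i b
    split_ifs
    · exact unitInterval.nonneg _
    · exact unitInterval.one_minus_nonneg _
  obtain ⟨U', hU'⟩ : ∃ V : Finset (σ → Bool), ∀ t, t ∈ V ↔ ∃ i, ∀ x, c x = i → t x = true :=
    ⟨univ.filter fun t => ∃ i, ∀ x, c x = i → t x = true, fun t => by simp⟩
  have key := SahiE3Dnf.latticeE3_nonneg_of_dnf hμ.nonneg hμ.mul_le_mul m c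
    (fun i => SahiE3MajSlot.supPrime_set_singleton (v i)) hF hA' hB'
    (fun i b => if b = true then (p (v i) : ℝ) else 1 - (p (v i) : ℝ)) hw zero_le_one
    (fun t => by rw [one_mul]; exact SahiE3DnfTwoKahn.mass_bernoulliWeight_fibre' p hv _ t (hF t)) U' hU'
  rw [← sahiE_three_indicator_eq_latticeE3 hμ.sum_eq_one] at key
  refine le_of_le_of_eq key ?_
  congr 1
  funext i
  fin_cases i
  · funext ω
    simp [setInd_apply, DecisionTree.ind, Set.singleton_subset_iff, hU']
  · funext ω
    simp [setInd_apply, DecisionTree.ind]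
  · funext ω
    simp [setInd_apply, DecisionTree.ind]

end Summit.CriticalPhenomena.PercolationContinuityZ3.Theorems.SahiE3DnfKahn
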